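import Mathlib
import HarnessLib

/-!
# Asymptotic Cauchy–Schwarz for four complex sequences

Pure analysis input for the line `Sketch` of the crux `ContinuumLegGivenGap`:
if `A, B, B', D : ℕ → ℂ` are eventually bounded and, for every fixed `μ : ℂ`, the
Gram-type combination `A k + μ B k + conj μ B' k + |μ|² D k` is eventually almost real and
almost nonnegative, then eventually `‖B k‖ ≤ √‖A k‖ √‖D k‖ + η` for every `η > 0`.

The proof is by compactness: if the conclusion failed frequently, an ultrafilter refining
`atTop` and the failure set would produce limits `a, b, b', d` for which the quadratic form
is *exactly* real and nonnegative for *all* `μ`; the algebraic lemma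
`norm_le_sqrt_mul_sqrt_of_forall` then gives `‖b‖ ≤ √‖a‖ √‖d‖`, contradicting the limit of
the failure inequality.
-/

noncomputable section

open Filter Topology

namespace Summit.QuantumFields.YangMills.Theorems.ContinuumLegGivenGap

/-- Algebraic core: if `a + μ b + conj μ b' + conj μ μ d` is real and nonnegative for every
`μ : ℂ`, then `‖b‖ ≤ √‖a‖ * √‖d‖`. -/
theorem norm_le_sqrt_mul_sqrt_of_forall (a b b' d : ℂ)
    (h : ∀ μ : ℂ, 0 ≤ (a + μ * b + (starRingEnd ℂ) μ * b' + (starRingEnd ℂ) μ * μ * d).re ∧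
      (a + μ * b + (starRingEnd ℂ) μ * b' + (starRingEnd ℂ) μ * μ * d).im = 0) :
    ‖b‖ ≤ Real.sqrt ‖a‖ * Real.sqrt ‖d‖ := by
  -- `μ = 0`: `a` is real and nonnegative.
  have ha_re : 0 ≤ a.re := by simpa using (h 0).1
  have ha_im : a.im = 0 := by simpa using (h 0).2
  -- `μ = 1, -1, I`: hermiticity `b' = conj b` (and `d` real).
  have h1 : a.im + b.im + b'.im + d.im = 0 := by
    have := (h 1).2
    simp at this
    linarith
  have h2 : a.im - b.im - b'.im + d.im = 0 := by
    have := (h (-1)).2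
    simp at this
    linarith
  have h3 : a.im + b.re - b'.re + d.im = 0 := by
    have := (h Complex.I).2
    simp at this
    linarith
  have hb're : b'.re = b.re := by linarith
  have hb'im : b'.im = -b.im := by linarith
  -- The real quadratic `s ↦ Re Q(-s • conj b)`.
  set n : ℝ := b.re * b.re + b.im * b.im with hn
  have hn0 : 0 ≤ n := add_nonneg (mul_self_nonneg _) (mul_self_nonneg _)
  have hnb : ‖b‖ ^ 2 = n := by rw [Complex.sq_norm, Complex.normSq_apply]
  have F4 : ∀ s : ℝ, 0 ≤ n * d.re * (s * s) + -(2 * n) * s + a.re := by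
    intro s
    have key := (h (-(s : ℂ) * (starRingEnd ℂ) b)).1
    have e : (a + -(s : ℂ) * (starRingEnd ℂ) b * b
        + (starRingEnd ℂ) (-(s : ℂ) * (starRingEnd ℂ) b) * b'
        + (starRingEnd ℂ) (-(s : ℂ) * (starRingEnd ℂ) b) * (-(s : ℂ) * (starRingEnd ℂ) b) * d).re
        = n * d.re * (s * s) + -(2 * n) * s + a.re := by
      simp only [map_mul, map_neg, Complex.conj_ofReal, Complex.conj_conj, Complex.add_re,
        Complex.mul_re, Complex.mul_im, Complex.neg_re, Complex.neg_im, Complex.ofReal_re,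
        Complex.ofReal_im, Complex.conj_re, Complex.conj_im, hb're, hb'im, hn]
      ring
    rw [e] at key
    exact key
  have hdisc := discrim_le_zero F4
  rw [discrim] at hdisc
  -- `n ≤ ‖a‖ ‖d‖`.
  have hle : n ≤ ‖a‖ * ‖d‖ := by
    rcases hn0.eq_or_lt with hzero | hpos
    · rw [← hzero]; positivity
    · have h5 : n ≤ a.re * d.re := by nlinarith
      calc n ≤ a.re * d.re := h5
        _ ≤ a.re * ‖d‖ := mul_le_mul_of_nonneg_left (Complex.re_le_norm d) ha_re
        _ ≤ ‖a‖ * ‖d‖ := mul_le_mul_of_nonneg_right (Complex.re_le_norm a) (norm_nonneg d)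
  calc ‖b‖ = Real.sqrt (‖b‖ ^ 2) := (Real.sqrt_sq (norm_nonneg b)).symm
    _ ≤ Real.sqrt (‖a‖ * ‖d‖) := Real.sqrt_le_sqrt (hnb ▸ hle)
    _ = Real.sqrt ‖a‖ * Real.sqrt ‖d‖ := Real.sqrt_mul (norm_nonneg a) _

/-- Along an ultrafilter, an eventually bounded complex sequence converges. -/
theorem exists_tendsto_of_eventually_norm_le (U : Ultrafilter ℕ) (s : ℕ → ℂ) (C : ℝ)
    (h : ∀ᶠ k in (U : Filter ℕ), ‖s k‖ ≤ C) : ∃ z : ℂ, Tendsto s (U : Filter ℕ) (𝓝 z) := by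
  have hmem : Metric.closedBall (0 : ℂ) C ∈ Ultrafilter.map s U := by
    rw [Ultrafilter.mem_map]
    filter_upwards [h] with k hk
    simpa [Metric.mem_closedBall, dist_zero_right] using hk
  obtain ⟨z, -, hz⟩ := (isCompact_closedBall (0 : ℂ) C).ultrafilter_le_nhds' _ hmem
  refine ⟨z, ?_⟩
  rw [Ultrafilter.coe_map] at hz
  exact hz

/-- **Asymptotic Cauchy–Schwarz.** If four complex sequences `A, B, B', D` are eventually
bounded and, for each fixed `μ : ℂ`, the combination `A k + μ B k + conj μ B' k + conj μ μ D k`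
is eventually almost real and almost nonnegative, then for every `η > 0` eventually
`‖B k‖ ≤ √‖A k‖ * √‖D k‖ + η`. -/
theorem stub_asympCS :
    ∀ (A B B' D : ℕ → ℂ),
      (∃ C : ℝ, ∀ᶠ k in atTop, ‖A k‖ ≤ C ∧ ‖B k‖ ≤ C ∧ ‖B' k‖ ≤ C ∧ ‖D k‖ ≤ C) →
      (∀ (μ : ℂ) (ε : ℝ), 0 < ε → ∀ᶠ k in atTop,
        -ε ≤ (A k + μ * B k + (starRingEnd ℂ) μ * B' k + (starRingEnd ℂ) μ * μ * D k).re ∧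
          |(A k + μ * B k + (starRingEnd ℂ) μ * B' k + (starRingEnd ℂ) μ * μ * D k).im| ≤ ε) →
      ∀ η : ℝ, 0 < η → ∀ᶠ k in atTop, ‖B k‖ ≤ Real.sqrt ‖A k‖ * Real.sqrt ‖D k‖ + η := by
  intro A B B' D hbd hpos η hη
  obtain ⟨C, hC⟩ := hbd
  by_contra hcon
  -- An ultrafilter refining `atTop` along which the conclusion fails.
  have hne : (atTop ⊓ 𝓟 {k | ¬(‖B k‖ ≤ Real.sqrt ‖A k‖ * Real.sqrt ‖D k‖ + η)}).NeBot :=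
    Filter.frequently_iff_neBot.mp (Filter.not_eventually.mp hcon)
  obtain ⟨U, hU⟩ := @Ultrafilter.exists_le _ _ hne
  have hUtop : (U : Filter ℕ) ≤ atTop := hU.trans inf_le_left
  have hUviol : ∀ᶠ k in (U : Filter ℕ), ¬(‖B k‖ ≤ Real.sqrt ‖A k‖ * Real.sqrt ‖D k‖ + η) :=
    hU (Filter.mem_inf_of_right (Filter.mem_principal_self _))
  -- Limits of the four sequences along `U`.
  have hCU : ∀ᶠ k in (U : Filter ℕ), ‖A k‖ ≤ C ∧ ‖B k‖ ≤ C ∧ ‖B' k‖ ≤ C ∧ ‖D k‖ ≤ C :=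
    hC.filter_mono hUtop
  obtain ⟨a, ha⟩ := exists_tendsto_of_eventually_norm_le U A C (hCU.mono fun k hk => hk.1)
  obtain ⟨b, hb⟩ := exists_tendsto_of_eventually_norm_le U B C (hCU.mono fun k hk => hk.2.1)
  obtain ⟨b', hb'⟩ :=
    exists_tendsto_of_eventually_norm_le U B' C (hCU.mono fun k hk => hk.2.2.1)
  obtain ⟨d, hd⟩ := exists_tendsto_of_eventually_norm_le U D C (hCU.mono fun k hk => hk.2.2.2)
  -- In the limit the quadratic form is exactly real and nonnegative, for every `μ`.
  have hq : ∀ μ : ℂ,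
      0 ≤ (a + μ * b + (starRingEnd ℂ) μ * b' + (starRingEnd ℂ) μ * μ * d).re ∧
        (a + μ * b + (starRingEnd ℂ) μ * b' + (starRingEnd ℂ) μ * μ * d).im = 0 := by
    intro μ
    have hT : Tendsto (fun k => A k + μ * B k + (starRingEnd ℂ) μ * B' k
        + (starRingEnd ℂ) μ * μ * D k) (U : Filter ℕ)
        (𝓝 (a + μ * b + (starRingEnd ℂ) μ * b' + (starRingEnd ℂ) μ * μ * d)) :=
      ((ha.add (hb.const_mul μ)).add (hb'.const_mul _)).add (hd.const_mul _)
    have hre : Tendsto (fun k => (A k + μ * B k + (starRingEnd ℂ) μ * B' k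
        + (starRingEnd ℂ) μ * μ * D k).re) (U : Filter ℕ)
        (𝓝 (a + μ * b + (starRingEnd ℂ) μ * b' + (starRingEnd ℂ) μ * μ * d).re) :=
      (Complex.continuous_re.tendsto _).comp hT
    have him : Tendsto (fun k => |(A k + μ * B k + (starRingEnd ℂ) μ * B' k
        + (starRingEnd ℂ) μ * μ * D k).im|) (U : Filter ℕ)
        (𝓝 |(a + μ * b + (starRingEnd ℂ) μ * b' + (starRingEnd ℂ) μ * μ * d).im|) :=
      ((Complex.continuous_im.tendsto _).comp hT).abs
    have key : ∀ ε : ℝ, 0 < ε →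
        -ε ≤ (a + μ * b + (starRingEnd ℂ) μ * b' + (starRingEnd ℂ) μ * μ * d).re ∧
          |(a + μ * b + (starRingEnd ℂ) μ * b' + (starRingEnd ℂ) μ * μ * d).im| ≤ ε := by
      intro ε hε
      have hev := (hpos μ ε hε).filter_mono hUtop
      exact ⟨ge_of_tendsto hre (hev.mono fun k hk => hk.1),
        le_of_tendsto him (hev.mono fun k hk => hk.2)⟩
    refine ⟨le_of_forall_pos_le_add fun ε hε => ?_, ?_⟩
    · linarith [(key ε hε).1]
    · have habs : |(a + μ * b + (starRingEnd ℂ) μ * b' + (starRingEnd ℂ) μ * μ * d).im| ≤ 0 :=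
        le_of_forall_pos_le_add fun ε hε => by linarith [(key ε hε).2]
      exact abs_nonpos_iff.mp habs
  have hcs := norm_le_sqrt_mul_sqrt_of_forall a b b' d hq
  -- Pass to the limit in the failure inequality.
  have hl1 : Tendsto (fun k => ‖B k‖) (U : Filter ℕ) (𝓝 ‖b‖) := hb.norm
  have hl2 : Tendsto (fun k => Real.sqrt ‖A k‖ * Real.sqrt ‖D k‖ + η) (U : Filter ℕ)
      (𝓝 (Real.sqrt ‖a‖ * Real.sqrt ‖d‖ + η)) :=
    (ha.norm.sqrt.mul hd.norm.sqrt).add tendsto_const_nhds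
  have hl3 : Real.sqrt ‖a‖ * Real.sqrt ‖d‖ + η ≤ ‖b‖ :=
    le_of_tendsto_of_tendsto hl2 hl1 (hUviol.mono fun k hk => (not_le.mp hk).le)
  linarith

end Summit.QuantumFields.YangMills.Theorems.ContinuumLegGivenGap

end
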